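import Summits.SmoothPoincare4.SmoothPoincare4.Theorems.EntropyRungNoncompactShrinkerGapHeatHypoellipticNoncompactChart
import HarnessLib

/-!
# Hypoellipticity of the heat operator on a non-compact manifold
(crux `EntropyRung.NoncompactShrinkerGap`, stmt-SmoothPoincare4-10868, line `collapsed-ends-usc`, v13)

Registered stub `helper_hypoelliptic_noncompact`: on a Riemannian manifold `(M, g)` modelled on
`ℝⁿ` (Hausdorff, second countable, `T3`, Borel — NOT compact), a measurable, locally integrable
very weak solution `u` of `∂ₛu = Δ_g u − Qu + G` on `M × T` (`T ⊆ ℝ` open, `Q, G` smooth on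
`M × ℝ`, test functions smooth with compact support in `M × T`) agrees a.e. with a function
smooth on `M × T`.

The tree proves this for CLOSED `M` and time-dependent metrics
(`exists_contMDiffOn_ae_eq_of_linearHeat_veryWeak`, `LinearHeatWeakRegularity.lean`), using
compactness only to synthesise `T3` and `SFinite dV_{g₀}`. Here the argument is re-run verbatim
with `[T3Space M] [SecondCountableTopology M]`: in each space-time chart the representative is a
very weak solution of a parabolic equation with smooth coefficients
(`integral_heatTranspose_chart_of_veryWeak_nc`), hence locally a.e. smooth by Hörmander's
theorem in coordinates (`exists_contDiffOn_ae_eq_of_heat_veryWeak`, from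
`hormander1967_thm11_proof`); local representatives are pulled back
(`ae_prod_chart_of_ae_volume_nc`) and patched (`exists_contMDiffOn_ae_eq_of_forall_exists_nhds`).
The static statement is the constant family `h ≡ g`, `g₀ = g`, whose density ratio is `1`.

## References

* L. Hörmander, *Hypoelliptic second order differential equations*, Acta Math. 119 (1967)
  147–171, Thm 1.1 and p. 147. [Hormander1967]
* I. Chavel, *Riemannian Geometry: A Modern Introduction*, 2nd ed., CUP 2006, §III.3, §III.7.
  [Chavel2006]
-/

noncomputable section

set_option linter.dupNamespace false

open Bundle Set Function Filter MeasureTheory Measure TopologicalSpace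
open scoped Manifold ContDiff Topology Matrix ENNReal
open Literature.Geometry.Riemannian Literature.Geometry.Lorentzian
  Literature.Geometry.Lorentzian.PseudoRiemannianMetric Literature.Analysis.Distribution

namespace Summit.SmoothPoincare4.SmoothPoincare4.Theorems.NoncompactShrinkerGapHeat

section Regularity

variable {m : ℕ} {H : Type*} [TopologicalSpace H]
  {I : ModelWithCorners ℝ (EuclideanSpace ℝ (Fin m)) H}
  {M : Type*} [TopologicalSpace M] [ChartedSpace H M]
  [IsManifold I ∞ M] [I.Boundaryless] [T3Space M] [SecondCountableTopology M]
  [MeasurableSpace M] [BorelSpace M]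
  {h : ℝ → PseudoRiemannianMetric I ∞ (EuclideanSpace ℝ (Fin m)) (TangentSpace I : M → Type _)}
  {g₀ : PseudoRiemannianMetric I ∞ (EuclideanSpace ℝ (Fin m)) (TangentSpace I : M → Type _)}

/-- **Interior regularity of very weak solutions of the linear heat equation on a (possibly
non-compact) manifold.** Let `h(s)` be a family of Riemannian metrics on the `T3`, second-countable
manifold `M` (modelled on `ℝᵐ`), `C^∞` on `M × ℝ`, `g₀` a Riemannian reference metric with density ratio
`ρ = dV_{h(s)}/dV_{g₀}`, `Q, G` smooth on `M × ℝ`, `T ⊆ ℝ` open, and let the measurable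
`u : M × ℝ → ℝ`, locally integrable on `M × T` for `dV_{g₀} ⊗ ds`, satisfy
`∫ u · (−∂ₛ(ρζ) − ρ Δ_{h(s)}ζ + ρQζ) = ∫ ρ G ζ` for all smooth `ζ` compactly supported in
`M × T` — the very weak form of **`∂ₛu = Δ_{h(s)}u − Qu + G`**. Then `u` agrees a.e. on `M × T`
with a function `C^∞` on `M × T`. Proof: in each space-time chart the representative is a very
weak solution of a parabolic equation with smooth coefficients
(`integral_heatTranspose_chart_of_veryWeak_nc`), hence locally a.e. smooth by Hörmander's theorem
(`exists_contDiffOn_ae_eq_of_heat_veryWeak`, from `hormander1967_thm11_proof`); the local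
representatives are pulled back (`ae_prod_chart_of_ae_volume_nc`) and patched
(`exists_contMDiffOn_ae_eq_of_forall_exists_nhds`). [cite: Hormander1967, Thm 1.1 and p. 147] -/
private theorem exists_contMDiffOn_ae_eq_of_linearHeat_veryWeak_nc
    (hh : IsContMDiffFamilyOn ∞ h univ) (hR : ∀ s, (h s).IsRiemannian) (hR₀ : g₀.IsRiemannian)
    {Q G : ℝ → M → ℝ} (hQ : ContMDiff (I.prod 𝓘(ℝ, ℝ)) 𝓘(ℝ, ℝ) ∞ fun p : M × ℝ ↦ Q p.2 p.1)
    (hG : ContMDiff (I.prod 𝓘(ℝ, ℝ)) 𝓘(ℝ, ℝ) ∞ fun p : M × ℝ ↦ G p.2 p.1)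
    {T : Set ℝ} (hT : IsOpen T) {u : M × ℝ → ℝ} (hum : Measurable u)
    (hu : LocallyIntegrableOn u (univ ×ˢ T) (g₀.riemVolume.prod (volume : Measure ℝ)))
    (hweak : ∀ ζ : M × ℝ → ℝ, ContMDiff (I.prod 𝓘(ℝ, ℝ)) 𝓘(ℝ, ℝ) ∞ ζ → HasCompactSupport ζ →
      tsupport ζ ⊆ univ ×ˢ T →
      ∫ p, u p * (-(deriv (fun s ↦ (h s).densityRatio g₀ p.1 * ζ (p.1, s)) p.2) -
          (h p.2).densityRatio g₀ p.1 * (h p.2).laplaceBeltrami (fun x ↦ ζ (x, p.2)) p.1 +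
          (h p.2).densityRatio g₀ p.1 * Q p.2 p.1 * ζ p) ∂g₀.riemVolume.prod (volume : Measure ℝ) =
        ∫ p, (h p.2).densityRatio g₀ p.1 * G p.2 p.1 * ζ p ∂g₀.riemVolume.prod (volume : Measure ℝ)) :
    ∃ v : M × ℝ → ℝ, ContMDiffOn (I.prod 𝓘(ℝ, ℝ)) 𝓘(ℝ, ℝ) ∞ v (univ ×ˢ T) ∧
      ∀ᵐ p ∂g₀.riemVolume.prod (volume : Measure ℝ), p ∈ univ ×ˢ T → u p = v p := by
  classical
  set μ₀ : Measure M := g₀.riemVolume with hμ₀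
  haveI : μ₀.IsOpenPosMeasure := by
    rw [hμ₀, riemVolume_eq hR₀]; exact isOpenPosMeasure_riemannianMeasure _
  haveI : (μ₀.prod (volume : Measure ℝ)).IsOpenPosMeasure := prod.instIsOpenPosMeasure
  refine exists_contMDiffOn_ae_eq_of_forall_exists_nhds (JX := I.prod 𝓘(ℝ, ℝ))
    (μ := μ₀.prod (volume : Measure ℝ)) fun p₀ hp₀ ↦ ?_
  obtain ⟨x₀, s₀⟩ := p₀
  have hs₀ : s₀ ∈ T := hp₀.2
  set φ := extChartAt I x₀ with hφ
  have hV : IsOpen φ.target := isOpen_extChartAt_target x₀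
  have hO : IsOpen (φ.target ×ˢ (univ : Set ℝ)) := hV.prod isOpen_univ
  have hΩ : IsOpen (φ.target ×ˢ T) := hV.prod hT
  have hΩO : φ.target ×ˢ T ⊆ φ.target ×ˢ (univ : Set ℝ) := prod_mono le_rfl (subset_univ _)
  -- the chart data
  set Jc : (EuclideanSpace ℝ (Fin m) × ℝ) → ℝ := fun q ↦
    Real.sqrt (chartGramMatrix ((h q.2).toContMDiffRiemannianMetric (hR q.2)) x₀ q.1).det with hJc
  set Ac : Fin m → Fin m → (EuclideanSpace ℝ (Fin m) × ℝ) → ℝ := fun k l q ↦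
    Jc q * (chartGramMatrix ((h q.2).toContMDiffRiemannianMetric (hR q.2)) x₀ q.1)⁻¹ k l with hAc
  set qc : (EuclideanSpace ℝ (Fin m) × ℝ) → ℝ := fun q ↦ Jc q * Q q.2 (φ.symm q.1) with hqc
  set Fc : (EuclideanSpace ℝ (Fin m) × ℝ) → ℝ := fun q ↦ Jc q * G q.2 (φ.symm q.1) with hFc
  -- smoothness of the chart data (as in the chart identity)
  set e := trivializationAt (EuclideanSpace ℝ (Fin m)) (TangentSpace I) x₀ with he
  set Gh : (EuclideanSpace ℝ (Fin m) × ℝ) → Fin m → Fin m → ℝ := fun q i j ↦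
    chartGramMatrix ((h q.2).toContMDiffRiemannianMetric (hR q.2)) x₀ q.1 i j with hGh
  have hofG : ∀ q, Matrix.of (Gh q) =
      chartGramMatrix ((h q.2).toContMDiffRiemannianMetric (hR q.2)) x₀ q.1 := fun q ↦ by ext i j; rfl
  have hGs : ∀ i j, ContDiffOn ℝ ∞ (fun q ↦ Gh q i j) (φ.target ×ˢ (univ : Set ℝ)) := fun i j ↦
    (hh.contDiffOn_gram_chart x₀ (EuclideanSpace.basisFun (Fin m) ℝ).toBasis i j).congr fun q hq ↦
      chartGramMatrix_apply_eq_val_localFrame _ x₀ hq.1 i j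
  have hdetpos : ∀ q ∈ φ.target ×ˢ (univ : Set ℝ), 0 < (Matrix.of (Gh q)).det := fun q hq ↦ by
    rw [hofG]; exact Real.sqrt_pos.1 (sqrt_det_chartGramMatrix_pos _ x₀ hq.1)
  have hGdet : ContDiffOn ℝ ∞ (fun q ↦ (Matrix.of (Gh q)).det) (φ.target ×ˢ (univ : Set ℝ)) := by
    intro q hq
    have h1 := contMDiffWithinAt_matrix_det (J := 𝓘(ℝ, (EuclideanSpace ℝ (Fin m) × ℝ))) (k := ∞)
      (A := fun q ↦ Matrix.of (Gh q)) (s := φ.target ×ˢ (univ : Set ℝ)) (x₀ := q)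
      (fun i j ↦ contMDiffWithinAt_iff_contDiffWithinAt.2 (hGs i j q hq))
    exact contMDiffWithinAt_iff_contDiffWithinAt.1 h1
  have hJcs : ContDiffOn ℝ ∞ Jc (φ.target ×ˢ (univ : Set ℝ)) := by
    have : Jc = fun q ↦ Real.sqrt (Matrix.of (Gh q)).det := funext fun q ↦ by rw [hJc, hofG]
    rw [this]
    exact hGdet.sqrt fun q hq ↦ (hdetpos q hq).ne'
  have hGinv : ∀ i l, ContDiffOn ℝ ∞ (fun q ↦ (Matrix.of (Gh q))⁻¹ i l) (φ.target ×ˢ (univ : Set ℝ)) := by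
    intro i l q hq
    have h1 := contMDiffWithinAt_matrix_inv (J := 𝓘(ℝ, (EuclideanSpace ℝ (Fin m) × ℝ))) (k := ∞)
      (A := fun q ↦ Matrix.of (Gh q)) (s := φ.target ×ˢ (univ : Set ℝ)) (x₀ := q)
      (fun i j ↦ contMDiffWithinAt_iff_contDiffWithinAt.2 (hGs i j q hq)) (hdetpos q hq).ne' i l
    exact contMDiffWithinAt_iff_contDiffWithinAt.1 h1
  have hAcs : ∀ k l, ContDiffOn ℝ ∞ (Ac k l) (φ.target ×ˢ (univ : Set ℝ)) := by
    intro k l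
    have : Ac k l = fun q ↦ Jc q * (Matrix.of (Gh q))⁻¹ k l := funext fun q ↦ by rw [hAc, hofG]
    rw [this]; exact hJcs.mul (hGinv k l)
  have hqcs : ContDiffOn ℝ ∞ qc (φ.target ×ˢ (univ : Set ℝ)) :=
    hJcs.mul (contDiffOn_time_chart (k := (⊤ : ℕ∞)) hQ.contMDiffOn x₀)
  have hFcs : ContDiffOn ℝ ∞ Fc (φ.target ×ˢ (univ : Set ℝ)) :=
    hJcs.mul (contDiffOn_time_chart (k := (⊤ : ℕ∞)) hG.contMDiffOn x₀)
  -- symmetry and positivity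
  have hAsymm : ∀ k l q, Ac k l q = Ac l k q := by
    intro k l q
    simp only [hAc]
    congr 1
    have hsym : (chartGramMatrix ((h q.2).toContMDiffRiemannianMetric (hR q.2)) x₀ q.1).IsSymm :=
      Matrix.IsSymm.ext fun i j ↦ chartGramMatrix_apply_comm _ x₀ q.1 j i
    exact (hsym.inv.apply k l).symm
  have hApos : ∀ q ∈ φ.target ×ˢ T, ∀ v : Fin m → ℝ, v ≠ 0 →
      0 < ∑ k, ∑ l, Ac k l q * (v k * v l) :=
    fun q hq v hv ↦ heatCoeff_chart_pos (hR q.2) x₀ hq.1 v hv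
  have hJpos : ∀ q ∈ φ.target ×ˢ T, 0 < Jc q := fun q hq ↦ sqrt_det_chartGramMatrix_pos _ x₀ hq.1
  -- local integrability of the representative and the chart identity
  have hū : LocallyIntegrableOn (fun q : (EuclideanSpace ℝ (Fin m) × ℝ) ↦ u (φ.symm q.1, q.2)) (φ.target ×ˢ T)
      (volume : Measure (EuclideanSpace ℝ (Fin m) × ℝ)) := locallyIntegrableOn_comp_chart_prod_nc hR₀ x₀ hT hum hu
  have hchart : ∀ ψ : (EuclideanSpace ℝ (Fin m) × ℝ) → ℝ, ContDiff ℝ ∞ ψ → HasCompactSupport ψ → tsupport ψ ⊆ φ.target ×ˢ T →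
      ∫ q, u (φ.symm q.1, q.2) * heatTranspose Ac Jc qc ψ q = ∫ q, Fc q * ψ q :=
    fun ψ hψ hψc hψT ↦ integral_heatTranspose_chart_of_veryWeak_nc hh hR hR₀ hQ hG hT hum hu hweak x₀
      Jc qc Fc Ac (fun _ ↦ rfl) (fun _ _ _ ↦ rfl) (fun _ ↦ rfl) (fun _ ↦ rfl) hψ hψc hψT
  -- Hörmander in the chart
  have hp₀Ω : ((φ x₀, s₀) : (EuclideanSpace ℝ (Fin m) × ℝ)) ∈ φ.target ×ˢ T := ⟨φ.map_source (mem_extChartAt_source x₀), hs₀⟩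
  obtain ⟨U, hUo, hpU, hUΩ, w, hw, hae⟩ := exists_contDiffOn_ae_eq_of_heat_veryWeak hΩ
    (fun k l ↦ (hAcs k l).mono hΩO) hAsymm hApos (hJcs.mono hΩO) hJpos (hqcs.mono hΩO)
    (hFcs.mono hΩO) hū hchart hp₀Ω
  -- pull back
  set V : Set (M × ℝ) := {p | p.1 ∈ φ.source ∧ ((φ p.1, p.2) : (EuclideanSpace ℝ (Fin m) × ℝ)) ∈ U} with hVdef
  have hΦc : ContinuousOn (fun p : M × ℝ ↦ ((φ p.1, p.2) : (EuclideanSpace ℝ (Fin m) × ℝ))) (φ.source ×ˢ (univ : Set ℝ)) :=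
    ((continuousOn_extChartAt x₀).comp continuous_fst.continuousOn
      (fun p hp ↦ hp.1)).prodMk continuous_snd.continuousOn
  have hVo : IsOpen V := by
    have h1 := hΦc.isOpen_inter_preimage ((isOpen_extChartAt_source x₀).prod isOpen_univ) hUo
    have : V = φ.source ×ˢ (univ : Set ℝ) ∩ (fun p : M × ℝ ↦ ((φ p.1, p.2) : (EuclideanSpace ℝ (Fin m) × ℝ))) ⁻¹' U := by
      ext p; simp [hVdef]
    rw [this]; exact h1
  have hpV : ((x₀, s₀) : M × ℝ) ∈ V := ⟨mem_extChartAt_source x₀, hpU⟩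
  have hVT : V ⊆ univ ×ˢ T := fun p hp ↦ ⟨mem_univ _, (hUΩ hp.2).2⟩
  refine ⟨V, hVo, hpV, hVT, fun p ↦ w (φ p.1, p.2), ?_, ?_⟩
  · have hwU : ContMDiffOn 𝓘(ℝ, (EuclideanSpace ℝ (Fin m) × ℝ)) 𝓘(ℝ, ℝ) ∞ w U := contMDiffOn_iff_contDiffOn.2 hw
    have hΦ : ContMDiffOn (I.prod 𝓘(ℝ, ℝ)) 𝓘(ℝ, (EuclideanSpace ℝ (Fin m) × ℝ)) ∞ (fun p : M × ℝ ↦ ((φ p.1, p.2) : (EuclideanSpace ℝ (Fin m) × ℝ))) V :=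
      (contMDiffOn_extChartAt_prod_id x₀ univ).mono fun p hp ↦ ⟨hp.1, mem_univ _⟩
    exact hwU.comp hΦ fun p hp ↦ hp.2
  · have h1 : ∀ᵐ p ∂μ₀.prod (volume : Measure ℝ),
        p.1 ∈ φ.source → ((φ p.1, p.2) : (EuclideanSpace ℝ (Fin m) × ℝ)) ∈ U → u (φ.symm (φ p.1), p.2) = w (φ p.1, p.2) :=
      ae_prod_chart_of_ae_volume_nc hR₀ x₀ (P := fun q : (EuclideanSpace ℝ (Fin m) × ℝ) ↦ q ∈ U → u (φ.symm q.1, q.2) = w q) hae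
    filter_upwards [h1] with p hp hpV
    have h2 := hp hpV.1 hpV.2
    rwa [φ.left_inv hpV.1] at h2

end Regularity

/-- **Hypoellipticity of the heat operator on a non-compact manifold, static metric.** Let
`(M, g)` be a Riemannian manifold modelled on `ℝⁿ` (Hausdorff, second countable, `T3`, Borel;
NOT assumed compact), `Q, G` smooth on `M × ℝ`, `T ⊆ ℝ` open, and let `u : M × ℝ → ℝ` be
measurable, locally integrable on `M × T` for `dV_g ⊗ ds`, and a very weak solution of
`∂ₛu = Δ_g u − Qu + G`: `∫ u (−∂ₛζ − Δ_g ζ + Qζ) = ∫ Gζ` for every smooth `ζ` compactly supported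
in `M × T`. Then `u` agrees a.e. on `M × T` with a function smooth on `M × T`. This is
`exists_contMDiffOn_ae_eq_of_linearHeat_veryWeak_nc` for the constant family `h ≡ g`, `g₀ = g`
(density ratio `≡ 1` since `♯ ∘ ♭ = id`). [cite: Hormander1967, Thm 1.1 and p. 147] -/
theorem helper_hypoelliptic_noncompact : ∀ (n : ℕ) (M : Type*) [TopologicalSpace M] [T2Space M] [SecondCountableTopology M] [ChartedSpace (EuclideanSpace ℝ (Fin n)) M] [IsManifold (𝓡 n) ∞ M] [T3Space M] [MeasurableSpace M] [BorelSpace M] (g : PseudoRiemannianMetric (𝓡 n) ∞ (EuclideanSpace ℝ (Fin n)) (TangentSpace (𝓡 n) : M → Type _)), g.IsRiemannian → ∀ (Q G : ℝ → M → ℝ), ContMDiff ((𝓡 n).prod 𝓘(ℝ, ℝ)) 𝓘(ℝ, ℝ) ∞ (fun p : M × ℝ ↦ Q p.2 p.1) → ContMDiff ((𝓡 n).prod 𝓘(ℝ, ℝ)) 𝓘(ℝ, ℝ) ∞ (fun p : M × ℝ ↦ G p.2 p.1) → ∀ (T : Set ℝ) (u : M × ℝ → ℝ), IsOpen T → Measurable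 u → LocallyIntegrableOn u (univ ×ˢ T) (g.riemVolume.prod (volume : Measure ℝ)) → (∀ ζ : M × ℝ → ℝ, ContMDiff ((𝓡 n).prod 𝓘(ℝ, ℝ)) 𝓘(ℝ, ℝ) ∞ ζ → HasCompactSupport ζ → tsupport ζ ⊆ univ ×ˢ T → ∫ p, u p * (-(deriv (fun s ↦ ζ (p.1, s)) p.2) - g.laplaceBeltrami (fun x ↦ ζ (x, p.2)) p.1 + Q p.2 p.1 * ζ p) ∂(g.riemVolume.prod (volume : Measure ℝ)) = ∫ p, G p.2 p.1 * ζ p ∂(g.riemVolume.prod (volume : Measure ℝ))) → ∃ v : M × ℝ → ℝ, ContMDiffOn ((𝓡 n).prod 𝓘(ℝ, ℝ)) 𝓘(ℝ, ℝ) ∞ v (univ ×ˢ T) ∧ ∀ᵐ p ∂(g.riemVolume.prod (volume : Measure ℝ)), p ∈ univ ×ˢ T → u p = v p := by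
  intro n M _ _ _ _ _ _ _ _ g hg Q G hQ hG T u hT hum hu hweak
  -- the density ratio of `g` with respect to itself is `1` (`♯ ∘ ♭ = id`, `det id = 1`)
  have hρ1 : ∀ x : M, g.densityRatio g x = 1 := fun x ↦ by
    have hid : (g.sharp x).toLinearMap ∘ₗ g.flat x = LinearMap.id := by
      apply LinearMap.ext
      intro v
      simp only [LinearMap.coe_comp, comp_apply, LinearMap.id_coe, id_eq, LinearEquiv.coe_coe]
      exact g.sharp_flat x v
    rw [densityRatio_def, hid, LinearMap.det_id, Real.sqrt_one]
  refine exists_contMDiffOn_ae_eq_of_linearHeat_veryWeak_nc (h := fun _ ↦ g) (g₀ := g)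
    (isContMDiffFamilyOn_const g univ) (fun _ ↦ hg) hg hQ hG hT hum hu ?_
  intro ζ hζ hζc hζT
  simp only [hρ1, one_mul]
  exact hweak ζ hζ hζc hζT

end Summit.SmoothPoincare4.SmoothPoincare4.Theorems.NoncompactShrinkerGapHeat

end
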